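import Summits.QuantumFields.YangMills.Theorems.BalabanUVNodesN20CoreEdgeShellDialAscent
import Summits.QuantumFields.YangMills.Theorems.BalabanUVNodesN20CoreEdgeShellDialAtKeyReading

/-!
# BalabanUVNodes ∕ N20 (NE7b) — the `hedge`-JOINT COMPANION, module 13N: THE DEVIATION LETTER IS NECESSARY — module 13L's intra-class one-sided ℓ¹ deviation (Dev)
# at ANY key reading is DOMINATED by the pinned two-sided ℓ¹ matching letter (the class ratio is ℓ¹-optimal among class-wise rescalings up to the coarse reverse
# mismatch); hence «pinned letters ⟺ letters at `kr` ∧ deviation letters at `kr`» for EVERY key reading `kr` (the window road is loss-free in the ℓ¹ currency), and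
# an UNSUMMABLE deviation floor at any one key reading refutes the pinned letters — and N21's face at every ℓ¹-optimal split — for every constant reading

Cell `pub-ymgap` (HUMAN RULING D-0062 Track A; D-0149 width push), seat `pub-ymgap-dag-n20-w3` (WIDTH SEAT 3 of 3 on NODE n20 = NE7b) gen 7, CLAIM-1 ∕ INTENT-1
(pub-ymgap INBOX l.35196).  Filed `--kind proof --supports stmt-QuantumFields-20544 --as helper` (K3⁷ `SpineGivenEndpointR13SepCoPH`; skeleton of record v5 941dddb108cbaacf);
COUNT-NEUTRAL.  ADDITIVE — imports this lineage's module 13L `…N20CoreEdgeShellDialAscent` (gen 6, p617153: `fiberSum_posPart_le_fibreDev_add`,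
`mismatchA∕B_record_of_keyReading_of_fibreDev`) and module 13K `…N20CoreEdgeShellDialAtKeyReading` (gen 6, p615422: `posPart_sum_le_sum_posPart`,
`mismatch_classVal_le_of_mismatch_le`); through them module 13 (p608626) and dag-n20-d's K edition ∕ KTower (p608328 ∕ p610265: `classSetK₁₃`, `weightAK₁₃ ∕ weightBK₁₃`,
`kr_mem_classSetK₁₃`); node U5d's `fiberSum` and the tree's SHAPE `T4IndicatorShell.ShellWeightBound` BY NAME; modifies nothing.
[III] = [Balaban1988Convergent], [LF-I∕II] = [Balaban1989LargeFieldI∕II], [King1986] = CMP 102.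

WHY.  Modules 13K ∕ 13L bracket the located two-run content of stub 2's (N19′, N21) pair in the ℓ¹ currency along every key reading `kr`:
`letter(kr) ≤ letter(pin) ≤ letter(kr) + Dev(kr)`, where for fine weights `p` (tested run), `q` (reference run), a class map `π` with fibre sums `P, Q`,
`Dev(π) := Σ_S (p − (P_{π s}∕Q_{π s})·q)⁺` is the one-sided ℓ¹ deviation of `p` from `q` rescaled to the CLASS ratio; module 13M PAYS (Dev) from a ratio-oscillation
letter on the good classes plus N20's bad mass.  Is (Dev) an EXTRA hypothesis of the window road, or part of the target?  THIS FILE answers: part of the target.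
* §1 [folklore] THE CLASS RATIO IS ℓ¹-OPTIMAL UP TO THE COARSE REVERSE MISMATCH.  For ANY class-wise multipliers `m : T → ℝ` (`q ≥ 0`):
  `Dev(π) ≤ Σ_S (p − m_{π s}·q)⁺ + Σ_T (m·Q − P)⁺ ≤ Σ_S (p − m_{π s}·q)⁺ + Σ_S (m_{π s}·q − p)⁺ = ‖p − (m∘π)·q‖_{ℓ¹(S)}`
  (★★ `fibreDev_le_mismatch_add_coarseReverse`, ★★ `fibreDev_le_l1Dist_classMul`): pointwise `p − (P∕Q)q = (p − m q) + (m − P∕Q)q`, `(x + y)⁺ ≤ x⁺ + y⁺`, and on a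
  fibre `(m − P∕Q)⁺·Q = (mQ − P)⁺` (module 13L's one-fibre inequality with the two ratio rôles exchanged; the second step is `x ↦ x⁺` subadditivity, module 13K).
  With a CONSTANT multiplier `m` and its inverse `m′` (`m·m′ = 1`, as `e^{∓c_K}` in module 13's letters): the two one-sided letters «`Σ_S (p − m q)⁺ ≤ w·Σ_S p`,
  `Σ_S (q − m′ p)⁺ ≤ w·Σ_S q`» give `m(1 − w)·Σ q ≤ Σ p` and hence ★★ `fibreDev_le_three_mul_of_letters`: `Dev(π) ≤ 3w·Σ_S p` for `w ≤ ½`, packaged without any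
  smallness row as ★★ `fibreDev_le_min_of_letters`: `Dev(π) ≤ min(1, 3w)·Σ_S p` (`Dev ≤ Σ p` always), the fraction `min(1, 3w_K)` being summable with `w`.
* §2 AT THE RECORD (dag-n20-d's K edition BY NAME; every key reading `kr`, every tuple with core provisos, `K`, `t`): ★★★ `fibreDevA∕B_record_le_of_l1Mismatch` — module
  13's two PINNED letters at `(K, t)` (fraction `w`, constants `c`) give module 13L's two deviation letters at `kr` with fraction `min 1 (3·w)`; with module 13K's descent
  (same `w` at `kr`) and module 13L's ascent (`w + v` back at the pin): ★★★ `pinnedLetters_iff_keyReadingLetters_and_fibreDev` — for EVERY `kr` and EVERY `c`,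
  «∃ summable `w ≥ 0`: the two pinned letters» ⟺ «∃ summable `w, v ≥ 0`: the two letters at `kr` ∧ the two deviation letters at `kr`».  In the ℓ¹ currency the window
  road is LOSS-FREE: (W at `kr`) + (Dev at `kr`) is not a weakening of the pinned target but a re-packaging of it, at every rung of dag-n20-d's key dial.
* §3 THE KILL IN THIS CURRENCY (the (N)-side of `Cruxes/SpineGivenEndpointR13SepCoPH/Ideas/window-key-core.md`, mass form): ★★★ `not_pinnedLetters_record_of_unsummable_fibreDevA`
  — an UNSUMMABLE deviation floor `d_K·Σ weightA₁₃ < Dev_A(kr)(K, t_K)`, `d ≥ 0`, `Σ d_K = ∞`, at ANY ONE key reading `kr` refutes the two pinned letters for EVERY constant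
  reading `c` and EVERY summable fraction; abstractly (★★ `not_shellWeightBound_optShell_of_unsummable_fibreDev`) it refutes N21's SHAPE `ShellWeightBound` at EVERY
  ℓ¹-optimal split `sh⋆(c)` of module 13 — no constant and no fraction rescue.  At the collapse (one class per step) `Dev_A = Z_A·TV(μ_A, μ_B)` and this is dag-n20-w4 ∕ w5's
  class-law kill (`exists_hybridNE7_iff_target_and_classLawTV` p609004, `…StubTwoFalseOfLawSeparated` p610536) read in mass; here it holds at every key reading.
LOCATED (for plan g85 ∕ idea-3 ∕ CRIT-1 ∕ the n19 ∕ n20 lanes; said, not decided): the honest bill of the window road for stub 2's (N19′, N21) pair at v5's pin is EXACTLY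
(W at the window key) + (Dev inside the window classes), neither more nor less, at every window floor; (Osc) + (N20) (module 13M) is ONE way to pay (Dev), and any
first-level-saturation ∕ law-separation phenomenon that makes (Dev) unsummable at some key reading kills the pinned pair at every constant — the kernel does not decide which.

HONEST FRAMING.  [folklore] finite-sum ∕ `max` arithmetic over node U5d's `fiberSum` and the tree's SHAPE `ShellWeightBound`, dag-n20-d's K edition and this lineage's
modules 13 ∕ 13K ∕ 13L BY NAME; count-neutral; proves NO estimate of the programme: every letter below is a HYPOTHESIS, inhabited for no Bałaban family today (A2 declared) —
(W), (Dev) and the deviation floor are two-run statements at keyed classes, NOT PRINTED for `d = 4`, NOT proved, NOT refuted; the hypothesis-free inequalities book NOTHING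
about Bałaban's objects beyond `0 ≤` class weights.  Nothing of Bałaban's asserted; no `Provisos₁₃CoPH` inhabitant claimed (K0⁷ OPEN); NE7 ∕ NE7b ∕ NE7c NOT PRINTED ∕ NOT
PROVED; N19 ∕ N20 ∕ N21 NOT discharged; K3⁷ NOT closed, not claimed, v5 STANDS; counts unmoved; no count claim.  One finite `𝕋⁴_{L^K}` programme at fixed `ε = L^{−K}`,
Bałaban AS PRINTED; the YM mass gap (Clay) is NOT proved by any of this — R4 closes the conditional finite-𝕋⁴ rung `BalabanLadder.UV` only; NOT ℝ⁴, NOT continuum, NOT OS.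
No `def`, no `instance`, no `notation`, no `sorry`, no private decls.  Sources (location only): [King1986] (3.10)–(3.13) pp.656–657; [LF-I] p.193; [LF-II] Thm 1 + (0.1)
pp.355–356, (1.80) p.384; [III] (2.18) p.257, p.244 l.20–29.
-/

noncomputable section

open Finset
open scoped BigOperators

namespace Summit.QuantumFields.YangMills.BalabanUVNodes.N20CoreEdgeShellDialDeviationNecessity

open Literature.MathematicalPhysics.QuantumFieldTheory.Balaban1983to89
open Literature.MathematicalPhysics.QuantumFieldTheory.Balaban1983to89.T4Continuum
open Literature.MathematicalPhysics.QuantumFieldTheory.Balaban1983to89.Node00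
open T4IndicatorShell (ShellWeightBound)
open T4MatchingAssembly (classVal sum_classVal classVal_nonneg)
open T4HybridMatching (fiberSum sum_fiberSum fiberSum_nonneg)
open Summit.QuantumFields.BalabanUV.T4Continuum.Spine YMDAG.UVSplit
open Summit.QuantumFields.YangMills.BalabanUVNodes.N21KeyedShellWeightShellZero (weightA₁₃_nonneg weightB₁₃_nonneg)
open Summit.QuantumFields.YangMills.BalabanUVNodes.N20CoreEdgeShellDialAscent (fiberSum_posPart_le_fibreDev_add
  mismatchA_record_of_keyReading_of_fibreDev mismatchB_record_of_keyReading_of_fibreDev)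
open Summit.QuantumFields.YangMills.BalabanUVNodes.N20CoreEdgeShellDialAtKeyReading (posPart_sum_le_sum_posPart mismatch_classVal_le_of_mismatch_le)

/-! ## §1 Abstract: the class ratio is ℓ¹-optimal among class-wise rescalings, up to the coarse reverse mismatch (node U5d's `fiberSum`) -/

section Fibre

variable {σ ι : Type*} [DecidableEq ι]

/-- Fibre sums see the integrand only on the fibre: integrands agreeing on `{π = τ}` have the same fibre sum above `τ`. [folklore] -/
theorem fiberSum_congr_fibre (S : Finset σ) (π : σ → ι) (τ : ι) {f g : σ → ℝ} (h : ∀ s ∈ S, π s = τ → f s = g s) :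
    fiberSum S π f τ = fiberSum S π g τ :=
  Finset.sum_congr rfl fun s hs => h s (Finset.mem_filter.mp hs).1 (Finset.mem_filter.mp hs).2

/-- Fibre sums are linear with CLASS-WISE coefficients: `fiberSum (m(π·)·q − p) τ = m τ·Q τ − P τ`. [folklore] -/
theorem fiberSum_classMul_sub (S : Finset σ) (π : σ → ι) (p q : σ → ℝ) (m : ι → ℝ) (τ : ι) :
    fiberSum S π (fun s => m (π s) * q s - p s) τ = m τ * fiberSum S π q τ - fiberSum S π p τ := by
  unfold fiberSum
  rw [Finset.mul_sum, ← Finset.sum_sub_distrib]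
  exact Finset.sum_congr rfl fun s hs => by simp only [(Finset.mem_filter.mp hs).2]

/-- **ON ONE FIBRE, TWO CLASS-WISE RATIOS**: `Σ_{fibre τ} (p − ρ₁(π·)·q)⁺ ≤ Σ_{fibre τ} (p − ρ₂(π·)·q)⁺ + (ρ₂ τ − ρ₁ τ)⁺·Q τ` for `q ≥ 0` — module 13L's one-fibre
inequality `fiberSum_posPart_le_fibreDev_add` (constant tested against class-wise) with the constant read as `ρ₁ τ` on the fibre. [folklore] -/
theorem fiberSum_posPart_le_of_classRatios (S : Finset σ) (π : σ → ι) (p q : σ → ℝ) (ρ₁ ρ₂ : ι → ℝ) (τ : ι) (hq : ∀ s ∈ S, 0 ≤ q s) :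
    fiberSum S π (fun s => max 0 (p s - ρ₁ (π s) * q s)) τ ≤
      fiberSum S π (fun s => max 0 (p s - ρ₂ (π s) * q s)) τ + max 0 (ρ₂ τ - ρ₁ τ) * fiberSum S π q τ := by
  rw [fiberSum_congr_fibre S π τ (f := fun s => max 0 (p s - ρ₁ (π s) * q s)) (g := fun s => max 0 (p s - ρ₁ τ * q s))
    (fun s _ hs => by rw [hs])]
  exact fiberSum_posPart_le_fibreDev_add S π p q (ρ₁ τ) ρ₂ τ hq

/-- **SUMMED OVER THE CLASSES**: for a class map `π : S → T` and any two class-wise ratios,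
`Σ_S (p − ρ₁(π·)·q)⁺ ≤ Σ_S (p − ρ₂(π·)·q)⁺ + Σ_T (ρ₂ − ρ₁)⁺·Q`. [folklore] -/
theorem sum_posPart_le_of_classRatios {S : Finset σ} {T : Finset ι} {π : σ → ι} (p q : σ → ℝ) (ρ₁ ρ₂ : ι → ℝ)
    (hmaps : ∀ s ∈ S, π s ∈ T) (hq : ∀ s ∈ S, 0 ≤ q s) :
    ∑ s ∈ S, max 0 (p s - ρ₁ (π s) * q s) ≤ ∑ s ∈ S, max 0 (p s - ρ₂ (π s) * q s) + ∑ τ ∈ T, max 0 (ρ₂ τ - ρ₁ τ) * fiberSum S π q τ := by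
  rw [← sum_fiberSum (fun s => max 0 (p s - ρ₁ (π s) * q s)) hmaps, ← sum_fiberSum (fun s => max 0 (p s - ρ₂ (π s) * q s)) hmaps,
    ← Finset.sum_add_distrib]
  exact Finset.sum_le_sum fun τ _ => fiberSum_posPart_le_of_classRatios S π p q ρ₁ ρ₂ τ hq

/-- The slack AT THE CLASS RATIO is a coarse reverse mismatch: `(m − P∕Q)⁺·Q ≤ (m·Q − P)⁺` for `Q ≥ 0` (equality when `Q > 0`; at `Q = 0` the left side vanishes). [folklore] -/
theorem posPart_sub_div_mul_le (m P Q : ℝ) (hQ : 0 ≤ Q) : max 0 (m - P / Q) * Q ≤ max 0 (m * Q - P) := by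
  rcases hQ.eq_or_lt with h | h
  · rw [← h, mul_zero]
    exact le_max_left _ _
  · rw [max_mul_of_nonneg _ _ hQ, zero_mul, sub_mul, div_mul_cancel₀ _ h.ne']

/-- **★★ THE CLASS RATIO IS ℓ¹-OPTIMAL UP TO THE COARSE REVERSE MISMATCH**: for a class map `π : S → T`, reference weights `q ≥ 0` and ANY class-wise multipliers
`m : T → ℝ`, module 13L's deviation `Dev(π) = Σ_S (p − (P_{π s}∕Q_{π s})·q)⁺` satisfies `Dev(π) ≤ Σ_S (p − m_{π s}·q)⁺ + Σ_T (m·Q − P)⁺` — the tested run's one-sided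
mismatch against the class-wise rescaled reference PLUS the reference's one-sided mismatch against the tested run AT THE COARSE KEY. [folklore] -/
theorem fibreDev_le_mismatch_add_coarseReverse {S : Finset σ} {T : Finset ι} {π : σ → ι} (p q : σ → ℝ) (m : ι → ℝ)
    (hmaps : ∀ s ∈ S, π s ∈ T) (hq : ∀ s ∈ S, 0 ≤ q s) :
    ∑ s ∈ S, max 0 (p s - fiberSum S π p (π s) / fiberSum S π q (π s) * q s) ≤
      ∑ s ∈ S, max 0 (p s - m (π s) * q s) + ∑ τ ∈ T, max 0 (m τ * fiberSum S π q τ - fiberSum S π p τ) :=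
  (sum_posPart_le_of_classRatios p q (fun τ => fiberSum S π p τ / fiberSum S π q τ) m hmaps hq).trans
    (add_le_add le_rfl (Finset.sum_le_sum fun τ _ => posPart_sub_div_mul_le (m τ) _ _ (fiberSum_nonneg hq τ)))

/-- **THE COARSE REVERSE MISMATCH IS AT MOST THE FINE ONE** (class-wise multipliers): `Σ_T (m·Q − P)⁺ ≤ Σ_S (m_{π s}·q − p)⁺` — `x ↦ x⁺` is subadditive on each fibre
(module 13K's descent, with the multiplier allowed to vary with the class). [folklore] -/
theorem sum_posPart_classMul_sub_le {S : Finset σ} {T : Finset ι} {π : σ → ι} (p q : σ → ℝ) (m : ι → ℝ) (hmaps : ∀ s ∈ S, π s ∈ T) :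
    ∑ τ ∈ T, max 0 (m τ * fiberSum S π q τ - fiberSum S π p τ) ≤ ∑ s ∈ S, max 0 (m (π s) * q s - p s) := by
  rw [← sum_fiberSum (fun s => max 0 (m (π s) * q s - p s)) hmaps]
  refine Finset.sum_le_sum fun τ _ => ?_
  rw [← fiberSum_classMul_sub S π p q m τ]
  unfold fiberSum
  exact posPart_sum_le_sum_posPart _ _

/-- **★★ (Dev) IS DOMINATED BY THE ℓ¹ DISTANCE TO ANY CLASS-WISE RESCALING OF THE REFERENCE RUN**: for `q ≥ 0` and ANY `m : ι → ℝ`,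
`Dev(π) ≤ Σ_S (p − m_{π s}·q)⁺ + Σ_S (m_{π s}·q − p)⁺ = ‖p − (m∘π)·q‖_{ℓ¹(S)}` (no class set named: the image of `π` serves).  In particular a CONSTANT `m` — the
two-sided form of module 13's pinned letter — dominates the deviation at EVERY key reading. [folklore] -/
theorem fibreDev_le_l1Dist_classMul (S : Finset σ) (π : σ → ι) (p q : σ → ℝ) (m : ι → ℝ) (hq : ∀ s ∈ S, 0 ≤ q s) :
    ∑ s ∈ S, max 0 (p s - fiberSum S π p (π s) / fiberSum S π q (π s) * q s) ≤
      ∑ s ∈ S, max 0 (p s - m (π s) * q s) + ∑ s ∈ S, max 0 (m (π s) * q s - p s) :=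
  have hmaps : ∀ s ∈ S, π s ∈ S.image π := fun _ hs => Finset.mem_image_of_mem π hs
  (fibreDev_le_mismatch_add_coarseReverse p q m hmaps hq).trans (add_le_add le_rfl (sum_posPart_classMul_sub_le p q m hmaps))

/-- (Dev) never exceeds the tested run's total: `Dev(π) ≤ Σ_S p` for `p, q ≥ 0` (the class ratios are `≥ 0`). [folklore] -/
theorem fibreDev_le_total (S : Finset σ) (π : σ → ι) (p q : σ → ℝ) (hp : ∀ s ∈ S, 0 ≤ p s) (hq : ∀ s ∈ S, 0 ≤ q s) :
    ∑ s ∈ S, max 0 (p s - fiberSum S π p (π s) / fiberSum S π q (π s) * q s) ≤ ∑ s ∈ S, p s :=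
  Finset.sum_le_sum fun s hs =>
    max_le (hp s hs) (sub_le_self _ (mul_nonneg (div_nonneg (fiberSum_nonneg hp _) (fiberSum_nonneg hq _)) (hq s hs)))

/-- **★★ THE TWO ONE-SIDED MATCHING LETTERS AT A CONSTANT PAY (Dev), FRACTION `3w`**: `p, q ≥ 0`, a multiplier `m ≥ 0` with inverse `m′` (`m·m′ = 1`), and the two
letters `Σ_S (p − m q)⁺ ≤ w·Σ_S p`, `Σ_S (q − m′ p)⁺ ≤ w·Σ_S q` with `0 ≤ w ≤ ½` ⇒ `Dev(π) ≤ 3w·Σ_S p` for EVERY class map `π`: the reverse letter gives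
`Σ_S (m q − p)⁺ = m·Σ_S (q − m′ p)⁺ ≤ m w·Σ q` and the total comparison `m(1 − w)·Σ q ≤ Σ p`, so `m·Σ q ≤ 2·Σ p`. [folklore] -/
theorem fibreDev_le_three_mul_of_letters (S : Finset σ) (π : σ → ι) (p q : σ → ℝ) {m m' w : ℝ} (hq : ∀ s ∈ S, 0 ≤ q s)
    (hm : 0 ≤ m) (hmm' : m * m' = 1) (hw0 : 0 ≤ w) (hw : w ≤ 1 / 2)
    (hA : ∑ s ∈ S, max 0 (p s - m * q s) ≤ w * ∑ s ∈ S, p s) (hB : ∑ s ∈ S, max 0 (q s - m' * p s) ≤ w * ∑ s ∈ S, q s) :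
    ∑ s ∈ S, max 0 (p s - fiberSum S π p (π s) / fiberSum S π q (π s) * q s) ≤ 3 * w * ∑ s ∈ S, p s := by
  have hdev : ∑ s ∈ S, max 0 (p s - fiberSum S π p (π s) / fiberSum S π q (π s) * q s) ≤
      ∑ s ∈ S, max 0 (p s - m * q s) + ∑ s ∈ S, max 0 (m * q s - p s) := fibreDev_le_l1Dist_classMul S π p q (fun _ => m) hq
  have hrev : ∑ s ∈ S, max 0 (m * q s - p s) = m * ∑ s ∈ S, max 0 (q s - m' * p s) := by
    rw [Finset.mul_sum]
    refine Finset.sum_congr rfl fun s _ => ?_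
    rw [mul_max_of_nonneg _ _ hm, mul_zero, mul_sub, ← mul_assoc, hmm', one_mul]
  have htot : m * ∑ s ∈ S, q s - ∑ s ∈ S, p s ≤ ∑ s ∈ S, max 0 (m * q s - p s) := by
    rw [Finset.mul_sum, ← Finset.sum_sub_distrib]
    exact Finset.sum_le_sum fun s _ => le_max_right _ _
  have hQ0 : 0 ≤ m * ∑ s ∈ S, q s := mul_nonneg hm (Finset.sum_nonneg hq)
  have hB' : ∑ s ∈ S, max 0 (m * q s - p s) ≤ w * (m * ∑ s ∈ S, q s) := by
    rw [hrev, ← mul_assoc, mul_comm w m, mul_assoc]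
    exact mul_le_mul_of_nonneg_left hB hm
  have hwX : w * (m * ∑ s ∈ S, q s) ≤ 1 / 2 * (m * ∑ s ∈ S, q s) := mul_le_mul_of_nonneg_right hw hQ0
  have hX2 : m * ∑ s ∈ S, q s ≤ 2 * ∑ s ∈ S, p s := by linarith
  have hwX2 : w * (m * ∑ s ∈ S, q s) ≤ w * (2 * ∑ s ∈ S, p s) := mul_le_mul_of_nonneg_left hX2 hw0
  linarith

/-- **★★ … PACKAGED WITHOUT A SMALLNESS ROW**: under the same two letters with ANY `w ≥ 0`, `Dev(π) ≤ min(1, 3w)·Σ_S p` (`Dev ≤ Σ p` always; `3w` when `w ≤ ½`). [folklore] -/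
theorem fibreDev_le_min_of_letters (S : Finset σ) (π : σ → ι) (p q : σ → ℝ) {m m' w : ℝ} (hp : ∀ s ∈ S, 0 ≤ p s) (hq : ∀ s ∈ S, 0 ≤ q s)
    (hm : 0 ≤ m) (hmm' : m * m' = 1) (hw0 : 0 ≤ w)
    (hA : ∑ s ∈ S, max 0 (p s - m * q s) ≤ w * ∑ s ∈ S, p s) (hB : ∑ s ∈ S, max 0 (q s - m' * p s) ≤ w * ∑ s ∈ S, q s) :
    ∑ s ∈ S, max 0 (p s - fiberSum S π p (π s) / fiberSum S π q (π s) * q s) ≤ min 1 (3 * w) * ∑ s ∈ S, p s := by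
  have h1 := fibreDev_le_total S π p q hp hq
  by_cases hw : w ≤ 1 / 2
  · rw [min_mul_of_nonneg _ _ (Finset.sum_nonneg hp), one_mul]
    exact le_min h1 (fibreDev_le_three_mul_of_letters S π p q hq hm hmm' hw0 hw hA hB)
  · rwa [min_eq_left (by linarith : (1 : ℝ) ≤ 3 * w), one_mul]

/-- The packaged fraction is non-negative … [folklore] -/
theorem min_one_three_mul_nonneg {w : ℕ → ℝ} (hw0 : ∀ K, 0 ≤ w K) (K : ℕ) : 0 ≤ min 1 (3 * w K) :=
  le_min zero_le_one (by linarith [hw0 K])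

/-- … and summable with `w` (`min(1, 3w) ≤ 3w`). [folklore] -/
theorem summable_min_one_three_mul {w : ℕ → ℝ} (hw0 : ∀ K, 0 ≤ w K) (hws : Summable w) : Summable fun K => min 1 (3 * w K) :=
  Summable.of_nonneg_of_le (min_one_three_mul_nonneg hw0) (fun _ => min_le_right _ _) (hws.mul_left 3)

end Fibre

/-! ### §1b The kill, abstract: an unsummable deviation floor at one class map refutes the two letters — and N21's shape at every ℓ¹-optimal split — for every constant -/

section Kill

variable {ι κ : Type*} [DecidableEq κ] {l₀ : ℝ} {T : ℕ → Finset ι} {A B : ℕ → ℝ → ι → ℝ} {π : ℕ → ι → κ} {d : ℕ → ℝ}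

/-- **★★ NO CONSTANT AND NO SUMMABLE FRACTION CARRY THE TWO PINNED LETTERS ABOVE AN UNSUMMABLE DEVIATION FLOOR.**  Non-negative weights `A, B` on carriers `T K`, a
class map `π K` per step, and a floor `d ≥ 0`, `Σ d_K = ∞`, with `d_K·Σ_{T K} A(K, t_K) < Dev_A(π K)(K, t_K)` at some `|t_K| ≤ l₀` for every `K` ⇒ there are NO
constants `c` and summable `w ≥ 0` with `Σ_{T K} (A − e^{−c_K}B)⁺ ≤ w_K·Σ A` and `Σ_{T K} (B − e^{c_K}A)⁺ ≤ w_K·Σ B` at all `K`, `|t| ≤ l₀` (§1: the letters force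
`Dev_A ≤ 3w_K·Σ A`, so `d ≤ 3w` would be summable). [folklore] -/
theorem not_l1Mismatch_of_unsummable_fibreDev
    (hA : ∀ (K : ℕ) (t : ℝ), |t| ≤ l₀ → ∀ τ ∈ T K, 0 ≤ A K t τ) (hB : ∀ (K : ℕ) (t : ℝ), |t| ≤ l₀ → ∀ τ ∈ T K, 0 ≤ B K t τ)
    (hd0 : ∀ K, 0 ≤ d K) (hds : ¬ Summable d)
    (hfloor : ∀ K, ∃ t, |t| ≤ l₀ ∧
      d K * ∑ τ ∈ T K, A K t τ < ∑ τ ∈ T K, max 0 (A K t τ - fiberSum (T K) (π K) (A K t) (π K τ) / fiberSum (T K) (π K) (B K t) (π K τ) * B K t τ)) :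
    ¬ ∃ (c w : ℕ → ℝ), (∀ K, 0 ≤ w K) ∧ Summable w ∧ ∀ (K : ℕ) (t : ℝ), |t| ≤ l₀ →
      (∑ τ ∈ T K, max 0 (A K t τ - Real.exp (-c K) * B K t τ) ≤ w K * ∑ τ ∈ T K, A K t τ) ∧
      (∑ τ ∈ T K, max 0 (B K t τ - Real.exp (c K) * A K t τ) ≤ w K * ∑ τ ∈ T K, B K t τ) := by
  rintro ⟨c, w, hw0, hws, hletters⟩
  refine hds (Summable.of_nonneg_of_le hd0 (fun K => ?_) (hws.mul_left 3))
  obtain ⟨t, ht, hfl⟩ := hfloor K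
  have hdev := fibreDev_le_min_of_letters (T K) (π K) (A K t) (B K t) (hA K t ht) (hB K t ht) (Real.exp_pos (-c K)).le
    (by rw [← Real.exp_add, neg_add_cancel, Real.exp_zero]) (hw0 K) (hletters K t ht).1 (hletters K t ht).2
  have hmin : min 1 (3 * w K) * ∑ τ ∈ T K, A K t τ ≤ 3 * w K * ∑ τ ∈ T K, A K t τ :=
    mul_le_mul_of_nonneg_right (min_le_right _ _) (Finset.sum_nonneg (hA K t ht))
  exact le_of_lt (lt_of_mul_lt_mul_right (hfl.trans_le (hdev.trans hmin)) (Finset.sum_nonneg (hA K t ht)))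

/-- **★★ … HENCE N21's SHAPE FAILS AT EVERY ℓ¹-OPTIMAL SPLIT**: above such a floor, for EVERY constants `c` and EVERY fraction `w`, module 13's optimal shells
`shA⋆ = (A − e^{−c}B)⁺`, `shB⋆ = (B − e^{c}A)⁺` do NOT satisfy `ShellWeightBound l₀ T A B shA⋆ shB⋆ w` (its `left ∕ right` rows ARE the two letters, `nonneg ∕ summable`
the fraction rows, `sh_nonneg ∕ sh_le` the sign rows).  The floor is a HYPOTHESIS on the two runs' keyed weights — NOT PRINTED, NOT proved, NOT refuted.
[cite: Balaban1989LargeFieldII, Thm 1 + (0.1) pp.355–356 (one-run template only)] [folklore] -/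
theorem not_shellWeightBound_optShell_of_unsummable_fibreDev (hd0 : ∀ K, 0 ≤ d K) (hds : ¬ Summable d)
    (hfloor : ∀ K, ∃ t, |t| ≤ l₀ ∧
      d K * ∑ τ ∈ T K, A K t τ < ∑ τ ∈ T K, max 0 (A K t τ - fiberSum (T K) (π K) (A K t) (π K τ) / fiberSum (T K) (π K) (B K t) (π K τ) * B K t τ))
    (c w : ℕ → ℝ) :
    ¬ ShellWeightBound l₀ T A B (fun K t τ => max 0 (A K t τ - Real.exp (-c K) * B K t τ))
      (fun K t τ => max 0 (B K t τ - Real.exp (c K) * A K t τ)) w := by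
  intro h
  have hA : ∀ (K : ℕ) (t : ℝ), |t| ≤ l₀ → ∀ τ ∈ T K, 0 ≤ A K t τ :=
    fun K t ht τ hτ => (h.sh_nonneg_left K t ht τ hτ).trans (h.sh_le_left K t ht τ hτ)
  have hB : ∀ (K : ℕ) (t : ℝ), |t| ≤ l₀ → ∀ τ ∈ T K, 0 ≤ B K t τ :=
    fun K t ht τ hτ => (h.sh_nonneg_right K t ht τ hτ).trans (h.sh_le_right K t ht τ hτ)
  exact not_l1Mismatch_of_unsummable_fibreDev hA hB hd0 hds hfloor ⟨c, w, h.nonneg, h.summable, fun K t ht => ⟨h.left K t ht, h.right K t ht⟩⟩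

end Kill

/-! ## §2 At the record: the deviation letters at EVERY key reading from module 13's pinned letters; the loss-free equivalence along dag-n20-d's key dial -/

section Record

variable {F : T4Family} {N : ℕ} [NeZero N] (K₀ : ℕ) (kr : KeyReading₁₃ N K₀) (θ : Stage13HParams F N) (hP : θ.Provisos₁₃CoPH F N)
  (g₀ : ℕ → ℝ) (os : List (ULoop F)) (c : ℕ → ℝ)

/-- **★★ (Dev) AT THE RECORD IS DOMINATED BY THE FINE FORWARD + COARSE REVERSE MISMATCH, run A** (every key reading `kr`, tuple, `K`, `t`, multiplier `m`): module 13L's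
run-A deviation ≤ module 13's run-A mismatch of `(weightA₁₃, m·weightB₁₃)` over `classSet₁₃` PLUS the reverse mismatch of the COARSE weights `(m·weightBK₁₃, weightAK₁₃)`
over `classSetK₁₃ kr` (§1 ★★ at n20-d's objects; `0 ≤ weightB₁₃` by dag-n20-w2). [bookkeeping] -/
theorem fibreDevA_record_le_mismatch_add_coarseReverse (m : ℝ) (K : ℕ) (t : ℝ) :
    ∑ x ∈ classSet₁₃ θ K₀ g₀ K, max 0 (weightA₁₃ θ hP K₀ g₀ os K t x -
        weightAK₁₃ θ hP K₀ g₀ os (kr F θ hP g₀ os) K t (kr F θ hP g₀ os K x) / weightBK₁₃ θ hP K₀ g₀ os (kr F θ hP g₀ os) K t (kr F θ hP g₀ os K x) *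
          weightB₁₃ θ hP K₀ g₀ os K t x) ≤
      ∑ x ∈ classSet₁₃ θ K₀ g₀ K, max 0 (weightA₁₃ θ hP K₀ g₀ os K t x - m * weightB₁₃ θ hP K₀ g₀ os K t x) +
        ∑ u ∈ classSetK₁₃ θ K₀ g₀ (kr F θ hP g₀ os) K,
          max 0 (m * weightBK₁₃ θ hP K₀ g₀ os (kr F θ hP g₀ os) K t u - weightAK₁₃ θ hP K₀ g₀ os (kr F θ hP g₀ os) K t u) := by
  letI : ∀ Kc, DecidableEq (SiteSeqKey F Kc) := fun _ => Classical.decEq _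
  exact fibreDev_le_mismatch_add_coarseReverse (S := classSet₁₃ θ K₀ g₀ K) (T := classSetK₁₃ θ K₀ g₀ (kr F θ hP g₀ os) K) (π := kr F θ hP g₀ os K)
    (weightA₁₃ θ hP K₀ g₀ os K t) (weightB₁₃ θ hP K₀ g₀ os K t) (fun _ => m) (fun x hx => kr_mem_classSetK₁₃ θ K₀ g₀ (kr F θ hP g₀ os) hx)
    (fun x _ => weightB₁₃_nonneg F θ hP K₀ g₀ os K t x)

/-- **★★ run B** (B tested against `m·`A; coarse reverse mismatch `(m·weightAK₁₃ − weightBK₁₃)⁺`). [bookkeeping] -/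
theorem fibreDevB_record_le_mismatch_add_coarseReverse (m : ℝ) (K : ℕ) (t : ℝ) :
    ∑ x ∈ classSet₁₃ θ K₀ g₀ K, max 0 (weightB₁₃ θ hP K₀ g₀ os K t x -
        weightBK₁₃ θ hP K₀ g₀ os (kr F θ hP g₀ os) K t (kr F θ hP g₀ os K x) / weightAK₁₃ θ hP K₀ g₀ os (kr F θ hP g₀ os) K t (kr F θ hP g₀ os K x) *
          weightA₁₃ θ hP K₀ g₀ os K t x) ≤
      ∑ x ∈ classSet₁₃ θ K₀ g₀ K, max 0 (weightB₁₃ θ hP K₀ g₀ os K t x - m * weightA₁₃ θ hP K₀ g₀ os K t x) +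
        ∑ u ∈ classSetK₁₃ θ K₀ g₀ (kr F θ hP g₀ os) K,
          max 0 (m * weightAK₁₃ θ hP K₀ g₀ os (kr F θ hP g₀ os) K t u - weightBK₁₃ θ hP K₀ g₀ os (kr F θ hP g₀ os) K t u) := by
  letI : ∀ Kc, DecidableEq (SiteSeqKey F Kc) := fun _ => Classical.decEq _
  exact fibreDev_le_mismatch_add_coarseReverse (S := classSet₁₃ θ K₀ g₀ K) (T := classSetK₁₃ θ K₀ g₀ (kr F θ hP g₀ os) K) (π := kr F θ hP g₀ os K)
    (weightB₁₃ θ hP K₀ g₀ os K t) (weightA₁₃ θ hP K₀ g₀ os K t) (fun _ => m) (fun x hx => kr_mem_classSetK₁₃ θ K₀ g₀ (kr F θ hP g₀ os) hx)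
    (fun x _ => weightA₁₃_nonneg F θ hP K₀ g₀ os K t x)

/-- **★★★ THE run-A DEVIATION LETTER AT EVERY KEY READING FROM MODULE 13's TWO PINNED LETTERS**: at `(K, t)`, the pinned run-A letter (multiplier `e^{−c_K}`) and the
pinned run-B letter (multiplier `e^{c_K}`) with fraction `w ≥ 0` ⇒ module 13L's run-A deviation letter at `kr` with fraction `min 1 (3·w)` — no smallness of `w`, no
positivity beyond `0 ≤` weights, EVERY `kr`.  The pinned letters are the two-run content — NOT PRINTED for `d = 4`, NOT proved. [bookkeeping] -/
theorem fibreDevA_record_le_of_l1Mismatch {w : ℝ} {K : ℕ} {t : ℝ} (hw0 : 0 ≤ w)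
    (hmA : ∑ x ∈ classSet₁₃ θ K₀ g₀ K, max 0 (weightA₁₃ θ hP K₀ g₀ os K t x - Real.exp (-c K) * weightB₁₃ θ hP K₀ g₀ os K t x)
      ≤ w * ∑ x ∈ classSet₁₃ θ K₀ g₀ K, weightA₁₃ θ hP K₀ g₀ os K t x)
    (hmB : ∑ x ∈ classSet₁₃ θ K₀ g₀ K, max 0 (weightB₁₃ θ hP K₀ g₀ os K t x - Real.exp (c K) * weightA₁₃ θ hP K₀ g₀ os K t x)
      ≤ w * ∑ x ∈ classSet₁₃ θ K₀ g₀ K, weightB₁₃ θ hP K₀ g₀ os K t x) :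
    ∑ x ∈ classSet₁₃ θ K₀ g₀ K, max 0 (weightA₁₃ θ hP K₀ g₀ os K t x -
        weightAK₁₃ θ hP K₀ g₀ os (kr F θ hP g₀ os) K t (kr F θ hP g₀ os K x) / weightBK₁₃ θ hP K₀ g₀ os (kr F θ hP g₀ os) K t (kr F θ hP g₀ os K x) *
          weightB₁₃ θ hP K₀ g₀ os K t x) ≤
      min 1 (3 * w) * ∑ x ∈ classSet₁₃ θ K₀ g₀ K, weightA₁₃ θ hP K₀ g₀ os K t x := by
  letI : ∀ Kc, DecidableEq (SiteSeqKey F Kc) := fun _ => Classical.decEq _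
  exact fibreDev_le_min_of_letters (S := classSet₁₃ θ K₀ g₀ K) (kr F θ hP g₀ os K) (weightA₁₃ θ hP K₀ g₀ os K t) (weightB₁₃ θ hP K₀ g₀ os K t)
    (fun x _ => weightA₁₃_nonneg F θ hP K₀ g₀ os K t x) (fun x _ => weightB₁₃_nonneg F θ hP K₀ g₀ os K t x) (Real.exp_pos _).le
    (by rw [← Real.exp_add, neg_add_cancel, Real.exp_zero]) hw0 hmA hmB

/-- **★★★ THE run-B DEVIATION LETTER AT EVERY KEY READING FROM THE SAME TWO PINNED LETTERS** (rôles exchanged: `e^{c_K}·e^{−c_K} = 1`). [bookkeeping] -/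
theorem fibreDevB_record_le_of_l1Mismatch {w : ℝ} {K : ℕ} {t : ℝ} (hw0 : 0 ≤ w)
    (hmA : ∑ x ∈ classSet₁₃ θ K₀ g₀ K, max 0 (weightA₁₃ θ hP K₀ g₀ os K t x - Real.exp (-c K) * weightB₁₃ θ hP K₀ g₀ os K t x)
      ≤ w * ∑ x ∈ classSet₁₃ θ K₀ g₀ K, weightA₁₃ θ hP K₀ g₀ os K t x)
    (hmB : ∑ x ∈ classSet₁₃ θ K₀ g₀ K, max 0 (weightB₁₃ θ hP K₀ g₀ os K t x - Real.exp (c K) * weightA₁₃ θ hP K₀ g₀ os K t x)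
      ≤ w * ∑ x ∈ classSet₁₃ θ K₀ g₀ K, weightB₁₃ θ hP K₀ g₀ os K t x) :
    ∑ x ∈ classSet₁₃ θ K₀ g₀ K, max 0 (weightB₁₃ θ hP K₀ g₀ os K t x -
        weightBK₁₃ θ hP K₀ g₀ os (kr F θ hP g₀ os) K t (kr F θ hP g₀ os K x) / weightAK₁₃ θ hP K₀ g₀ os (kr F θ hP g₀ os) K t (kr F θ hP g₀ os K x) *
          weightA₁₃ θ hP K₀ g₀ os K t x) ≤
      min 1 (3 * w) * ∑ x ∈ classSet₁₃ θ K₀ g₀ K, weightB₁₃ θ hP K₀ g₀ os K t x := by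
  letI : ∀ Kc, DecidableEq (SiteSeqKey F Kc) := fun _ => Classical.decEq _
  exact fibreDev_le_min_of_letters (S := classSet₁₃ θ K₀ g₀ K) (kr F θ hP g₀ os K) (weightB₁₃ θ hP K₀ g₀ os K t) (weightA₁₃ θ hP K₀ g₀ os K t)
    (fun x _ => weightB₁₃_nonneg F θ hP K₀ g₀ os K t x) (fun x _ => weightA₁₃_nonneg F θ hP K₀ g₀ os K t x) (Real.exp_pos _).le
    (by rw [← Real.exp_add, add_neg_cancel, Real.exp_zero]) hw0 hmB hmA

/-- **★★★ THE WINDOW ROAD IS LOSS-FREE IN THE ℓ¹ CURRENCY — PINNED LETTERS ⟺ LETTERS AT `kr` ∧ DEVIATION LETTERS AT `kr`, FOR EVERY KEY READING `kr` AND EVERY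
CONSTANTS `c`.**  Left: module 13's two pinned letters at every `K`, `|t| ≤ 1` with ONE summable fraction `w ≥ 0` (the hypotheses of its
`shellWeightBound_crOfRecord₁₃VAt_optShell_of_l1Mismatch` verbatim).  Right: module 13K §2's two letters for the `kr`-COARSE weights (fraction `w`) AND module 13L §2's two
deviation letters (fraction `v`), `w, v ≥ 0` summable (the hypotheses of 13L's `shellWeightBound_crOfRecord₁₃VAt_optShell_of_keyReading_of_fibreDev` verbatim).
`→`: descent (13K `mismatch_classVal_le_of_mismatch_le`, same `w`) and necessity (§2 ★★★, `v := min 1 (3w)`); `←`: ascent (13L `mismatchA∕B_record_of_keyReading_of_fibreDev`,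
fraction `w + v`).  Both sides are two-run statements — NOT PRINTED for `d = 4`, NOT proved; the equivalence books nothing about them beyond their equivalence.
[cite: Balaban1989LargeFieldII, (1.80) p.384 (the window — bookkeeping only)] [bookkeeping] -/
theorem pinnedLetters_iff_keyReadingLetters_and_fibreDev :
    (∃ w : ℕ → ℝ, (∀ K, 0 ≤ w K) ∧ Summable w ∧ ∀ (K : ℕ) (t : ℝ), |t| ≤ 1 →
      (∑ x ∈ classSet₁₃ θ K₀ g₀ K, max 0 (weightA₁₃ θ hP K₀ g₀ os K t x - Real.exp (-c K) * weightB₁₃ θ hP K₀ g₀ os K t x)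
          ≤ w K * ∑ x ∈ classSet₁₃ θ K₀ g₀ K, weightA₁₃ θ hP K₀ g₀ os K t x) ∧
      (∑ x ∈ classSet₁₃ θ K₀ g₀ K, max 0 (weightB₁₃ θ hP K₀ g₀ os K t x - Real.exp (c K) * weightA₁₃ θ hP K₀ g₀ os K t x)
          ≤ w K * ∑ x ∈ classSet₁₃ θ K₀ g₀ K, weightB₁₃ θ hP K₀ g₀ os K t x)) ↔
    (∃ w v : ℕ → ℝ, (∀ K, 0 ≤ w K) ∧ Summable w ∧ (∀ K, 0 ≤ v K) ∧ Summable v ∧ ∀ (K : ℕ) (t : ℝ), |t| ≤ 1 →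
      (∑ u ∈ classSetK₁₃ θ K₀ g₀ (kr F θ hP g₀ os) K,
            max 0 (weightAK₁₃ θ hP K₀ g₀ os (kr F θ hP g₀ os) K t u - Real.exp (-c K) * weightBK₁₃ θ hP K₀ g₀ os (kr F θ hP g₀ os) K t u)
          ≤ w K * ∑ u ∈ classSetK₁₃ θ K₀ g₀ (kr F θ hP g₀ os) K, weightAK₁₃ θ hP K₀ g₀ os (kr F θ hP g₀ os) K t u) ∧
      (∑ u ∈ classSetK₁₃ θ K₀ g₀ (kr F θ hP g₀ os) K,
            max 0 (weightBK₁₃ θ hP K₀ g₀ os (kr F θ hP g₀ os) K t u - Real.exp (c K) * weightAK₁₃ θ hP K₀ g₀ os (kr F θ hP g₀ os) K t u)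
          ≤ w K * ∑ u ∈ classSetK₁₃ θ K₀ g₀ (kr F θ hP g₀ os) K, weightBK₁₃ θ hP K₀ g₀ os (kr F θ hP g₀ os) K t u) ∧
      (∑ x ∈ classSet₁₃ θ K₀ g₀ K, max 0 (weightA₁₃ θ hP K₀ g₀ os K t x -
            weightAK₁₃ θ hP K₀ g₀ os (kr F θ hP g₀ os) K t (kr F θ hP g₀ os K x) / weightBK₁₃ θ hP K₀ g₀ os (kr F θ hP g₀ os) K t (kr F θ hP g₀ os K x) *
              weightB₁₃ θ hP K₀ g₀ os K t x)
          ≤ v K * ∑ x ∈ classSet₁₃ θ K₀ g₀ K, weightA₁₃ θ hP K₀ g₀ os K t x) ∧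
      (∑ x ∈ classSet₁₃ θ K₀ g₀ K, max 0 (weightB₁₃ θ hP K₀ g₀ os K t x -
            weightBK₁₃ θ hP K₀ g₀ os (kr F θ hP g₀ os) K t (kr F θ hP g₀ os K x) / weightAK₁₃ θ hP K₀ g₀ os (kr F θ hP g₀ os) K t (kr F θ hP g₀ os K x) *
              weightA₁₃ θ hP K₀ g₀ os K t x)
          ≤ v K * ∑ x ∈ classSet₁₃ θ K₀ g₀ K, weightB₁₃ θ hP K₀ g₀ os K t x)) := by
  letI : ∀ Kc, DecidableEq (SiteSeqKey F Kc) := fun _ => Classical.decEq _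
  have hmaps : ∀ K, ∀ x ∈ classSet₁₃ θ K₀ g₀ K, kr F θ hP g₀ os K x ∈ classSetK₁₃ θ K₀ g₀ (kr F θ hP g₀ os) K :=
    fun K x hx => kr_mem_classSetK₁₃ θ K₀ g₀ (kr F θ hP g₀ os) hx
  constructor
  · rintro ⟨w, hw0, hws, h⟩
    refine ⟨w, fun K => min 1 (3 * w K), hw0, hws, min_one_three_mul_nonneg hw0, summable_min_one_three_mul hw0 hws, fun K t ht => ⟨?_, ?_, ?_, ?_⟩⟩
    · exact mismatch_classVal_le_of_mismatch_le (S := classSet₁₃ θ K₀ g₀) (π := kr F θ hP g₀ os) (p := weightA₁₃ θ hP K₀ g₀ os)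
        (q := weightB₁₃ θ hP K₀ g₀ os) hmaps (h K t ht).1
    · exact mismatch_classVal_le_of_mismatch_le (S := classSet₁₃ θ K₀ g₀) (π := kr F θ hP g₀ os) (p := weightB₁₃ θ hP K₀ g₀ os)
        (q := weightA₁₃ θ hP K₀ g₀ os) hmaps (h K t ht).2
    · exact fibreDevA_record_le_of_l1Mismatch K₀ kr θ hP g₀ os c (hw0 K) (h K t ht).1 (h K t ht).2
    · exact fibreDevB_record_le_of_l1Mismatch K₀ kr θ hP g₀ os c (hw0 K) (h K t ht).1 (h K t ht).2
  · rintro ⟨w, v, hw0, hws, hv0, hvs, h⟩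
    refine ⟨fun K => w K + v K, fun K => add_nonneg (hw0 K) (hv0 K), hws.add hvs, fun K t ht => ⟨?_, ?_⟩⟩
    · exact mismatchA_record_of_keyReading_of_fibreDev K₀ kr θ hP g₀ os (h K t ht).1 (h K t ht).2.2.1
    · exact mismatchB_record_of_keyReading_of_fibreDev K₀ kr θ hP g₀ os (h K t ht).2.1 (h K t ht).2.2.2

/-- **★★★ THE KILL AT THE RECORD: AN UNSUMMABLE run-A DEVIATION FLOOR AT ANY ONE KEY READING REFUTES THE PINNED LETTERS FOR EVERY CONSTANT READING.**  If at some key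
reading `kr` the run-A deviation of the record's class weights exceeds `d_K·Σ weightA₁₃` at some `|t_K| ≤ 1` for every `K`, with `d ≥ 0` NOT summable, then for NO constants
`c` and NO summable `w ≥ 0` do module 13's two pinned letters hold at all `K`, `|t| ≤ 1` — so the N21 face of stub 2 is not served at ANY ℓ¹-optimal split by this road
(§1b for the abstract `ShellWeightBound` form).  The floor is a HYPOTHESIS on Bałaban's two-run keyed weights (where first-level saturation ∕ law separation would have to
show up in this currency) — NOT PRINTED, NOT proved, NOT refuted; nothing here decides it. [bookkeeping] -/
theorem not_pinnedLetters_record_of_unsummable_fibreDevA {d : ℕ → ℝ} (hd0 : ∀ K, 0 ≤ d K) (hds : ¬ Summable d)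
    (hfloor : ∀ K, ∃ t, |t| ≤ 1 ∧ d K * ∑ x ∈ classSet₁₃ θ K₀ g₀ K, weightA₁₃ θ hP K₀ g₀ os K t x <
      ∑ x ∈ classSet₁₃ θ K₀ g₀ K, max 0 (weightA₁₃ θ hP K₀ g₀ os K t x -
        weightAK₁₃ θ hP K₀ g₀ os (kr F θ hP g₀ os) K t (kr F θ hP g₀ os K x) / weightBK₁₃ θ hP K₀ g₀ os (kr F θ hP g₀ os) K t (kr F θ hP g₀ os K x) *
          weightB₁₃ θ hP K₀ g₀ os K t x)) :
    ¬ ∃ (c w : ℕ → ℝ), (∀ K, 0 ≤ w K) ∧ Summable w ∧ ∀ (K : ℕ) (t : ℝ), |t| ≤ 1 →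
      (∑ x ∈ classSet₁₃ θ K₀ g₀ K, max 0 (weightA₁₃ θ hP K₀ g₀ os K t x - Real.exp (-c K) * weightB₁₃ θ hP K₀ g₀ os K t x)
          ≤ w K * ∑ x ∈ classSet₁₃ θ K₀ g₀ K, weightA₁₃ θ hP K₀ g₀ os K t x) ∧
      (∑ x ∈ classSet₁₃ θ K₀ g₀ K, max 0 (weightB₁₃ θ hP K₀ g₀ os K t x - Real.exp (c K) * weightA₁₃ θ hP K₀ g₀ os K t x)
          ≤ w K * ∑ x ∈ classSet₁₃ θ K₀ g₀ K, weightB₁₃ θ hP K₀ g₀ os K t x) := by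
  letI : ∀ Kc, DecidableEq (SiteSeqKey F Kc) := fun _ => Classical.decEq _
  exact not_l1Mismatch_of_unsummable_fibreDev (l₀ := 1) (T := classSet₁₃ θ K₀ g₀) (A := weightA₁₃ θ hP K₀ g₀ os) (B := weightB₁₃ θ hP K₀ g₀ os)
    (π := kr F θ hP g₀ os) (fun K t _ x _ => weightA₁₃_nonneg F θ hP K₀ g₀ os K t x) (fun K t _ x _ => weightB₁₃_nonneg F θ hP K₀ g₀ os K t x) hd0 hds hfloor

end Record

end Summit.QuantumFields.YangMills.BalabanUVNodes.N20CoreEdgeShellDialDeviationNecessity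

end
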